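import Summits.CriticalPhenomena.PercolationContinuityZ3.Theorems.Transplant.FKConnectivityAllQAntipodalUpc
import HarnessLib

/-!
# Connectivity correlation inequalities for `φ_{w,q}`, every `q > 0` — file 75b-i: **INDICATOR ARITHMETIC AND THE CROSS FORM
# OF THE ODD / EVEN DECOMPOSITION ACROSS A 2-SEPARATION**

Support file (`--supports stmt-CriticalPhenomena-4575`), FK sub-lane `prim-bschramm-fk-2` (gen 33/34); builds on p205010 (kernel theorem,
internal audit signed; external expert review pending).  No definitions, no named facts, no sorries; standard axioms.

Across a two-terminal gluing `E₁ ∥_{s,t} E₂` the level of a complementary pair is `ℓ₁(γ₁) + ℓ₂(γ₂) + [a₁ ∧ a₂] + [b₁ ∧ b₂]` (up to a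
constant), where `a_i` / `b_i` record whether `s ↔ t` on the `γ`-side / the complement side of block `i` (`FK.apExpC_parallel`).  This
file holds the pure bookkeeping of file 75b (`FK.levels_le_twoSum_nonpos_of_UU`, file `…TwoSumReduction`):
* `indPair_contract/_live/_del` (+ mirrors `₂`): the symmetrised level indicator of the four TYPES of the fixed block is twice the indicator of
  the contracted cell, the sum of the two indicators of the live cell, or twice the indicator of the deleted cell;
* `indDiff_kernel`: the antisymmetrised indicator is `−1{ℓ₁+ℓ₂ = m}·([a₁]−[b₁])([a₂]−[b₂])`;
* **`twoSum_cross_le`**: the abstract cross-term computation — for any two finite families with complement-flip symmetries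
  (`ℓ_i` even, `a_i ↔ b_i` exchanged, `f̂(γ̄₁,γ₂) = −f̂(γ₁,γ̄₂)`), the `PD + EQ` part of the odd / even expansion under the typed level
  indicator equals `−½·𝕌`, hence is `≤ 0` as soon as the double-U form `𝕌` is `≥ 0`.
[cite: Grimmett2006, §3.8 Thm. (3.90) (pp. 61–62); §3.9 (pp. 63–64)] [cite: Wagner2006, Thm. 5.8(d), §5.3]
-/

noncomputable section

namespace Summit.CriticalPhenomena.PercolationContinuityZ3.Theorems

namespace FK

open SimpleGraph Literature.Probability.LatticeModels Literature.Probability.Percolation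
open scoped Classical

variable {V : Type*}

/-! ### Indicator arithmetic for the three cell types (pure bookkeeping) -/
/-- Type `(1,1)` of the fixed side: both indicator summands are the contracted cell's indicator. [folklore] -/
theorem indPair_contract (ℓ₁ ℓ₂ ℓc m : ℕ) (A₁ B₁ A₂ B₂ : Bool) (hA : A₂ = true) (hB : B₂ = true)
    (hc : ℓc + 2 = ℓ₁ + (if A₁ = true then 1 else 0) + (if B₁ = true then 1 else 0)) (hlc : 1 ≤ ℓc) (x : ℝ) :
    ((if ℓ₁ + ℓ₂ + (if A₁ = true ∧ A₂ = true then 1 else 0) + (if B₁ = true ∧ B₂ = true then 1 else 0) ≤ m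
          then (1 : ℝ) else 0) +
        (if ℓ₁ + ℓ₂ + (if A₁ = true ∧ B₂ = true then 1 else 0) + (if B₁ = true ∧ A₂ = true then 1 else 0) ≤ m
          then (1 : ℝ) else 0)) * x =
      2 * (if ℓc ≤ m - ℓ₂ - 2 then x else 0) := by
  subst hA; subst hB
  cases A₁ <;> cases B₁ <;>
    simp only [Bool.false_eq_true, and_self, and_true, if_true, if_false, add_zero] at hc ⊢ <;>
    split_ifs <;> first | (exfalso; omega) | ring
/-- Types `(1,0)` / `(0,1)` of the fixed side: the two summands are the live cell's indicators at `γ` and `γ ∪ {st}`. [folklore] -/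
theorem indPair_live (ℓ₁ ℓ₂ ℓa ℓb m : ℕ) (A₁ B₁ A₂ B₂ : Bool) (hAB : (A₂ = true ∧ B₂ = false) ∨ (A₂ = false ∧ B₂ = true))
    (hca : ℓa + 1 = ℓ₁ + (if A₁ = true then 1 else 0)) (hcb : ℓb + 1 = ℓ₁ + (if B₁ = true then 1 else 0))
    (hla : 1 ≤ ℓa) (hlb : 1 ≤ ℓb) (x : ℝ) :
    ((if ℓ₁ + ℓ₂ + (if A₁ = true ∧ A₂ = true then 1 else 0) + (if B₁ = true ∧ B₂ = true then 1 else 0) ≤ m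
          then (1 : ℝ) else 0) +
        (if ℓ₁ + ℓ₂ + (if A₁ = true ∧ B₂ = true then 1 else 0) + (if B₁ = true ∧ A₂ = true then 1 else 0) ≤ m
          then (1 : ℝ) else 0)) * x =
      (if ℓb ≤ m - ℓ₂ - 1 then x else 0) + (if ℓa ≤ m - ℓ₂ - 1 then x else 0) := by
  rcases hAB with ⟨hA, hB⟩ | ⟨hA, hB⟩ <;> subst hA <;> subst hB <;> cases A₁ <;> cases B₁ <;>
    simp only [Bool.false_eq_true, and_false, and_self, and_true, if_true, if_false,
      add_zero] at hca hcb ⊢ <;>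
    split_ifs <;> first | (exfalso; omega) | ring
/-- Type `(0,0)` of the fixed side: both summands are the deleted cell's indicator. [folklore] -/
theorem indPair_del (ℓ₁ ℓ₂ m : ℕ) (A₁ B₁ A₂ B₂ : Bool) (hA : A₂ = false) (hB : B₂ = false) (hl : 1 ≤ ℓ₁) (x : ℝ) :
    ((if ℓ₁ + ℓ₂ + (if A₁ = true ∧ A₂ = true then 1 else 0) + (if B₁ = true ∧ B₂ = true then 1 else 0) ≤ m
          then (1 : ℝ) else 0) +
        (if ℓ₁ + ℓ₂ + (if A₁ = true ∧ B₂ = true then 1 else 0) + (if B₁ = true ∧ A₂ = true then 1 else 0) ≤ m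
          then (1 : ℝ) else 0)) * x =
      2 * (if ℓ₁ ≤ m - ℓ₂ then x else 0) := by
  subst hA; subst hB
  simp only [Bool.false_eq_true, and_false, if_false, add_zero]
  split_ifs <;> first | (exfalso; omega) | ring
/-- **The cross kernel**: `1{ℓ₁+ℓ₂+[A₁∧A₂]+[B₁∧B₂] ≤ m} − 1{ℓ₁+ℓ₂+[B₁∧A₂]+[A₁∧B₂] ≤ m} = −1{ℓ₁+ℓ₂ = m}·([A₁]−[B₁])([A₂]−[B₂])`. [folklore] -/
theorem indDiff_kernel (ℓ₁ ℓ₂ m : ℕ) (A₁ B₁ A₂ B₂ : Bool) :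
    ((if ℓ₁ + ℓ₂ + (if A₁ = true ∧ A₂ = true then 1 else 0) + (if B₁ = true ∧ B₂ = true then 1 else 0) ≤ m
          then (1 : ℝ) else 0) -
        (if ℓ₁ + ℓ₂ + (if B₁ = true ∧ A₂ = true then 1 else 0) + (if A₁ = true ∧ B₂ = true then 1 else 0) ≤ m
          then (1 : ℝ) else 0)) =
      -(if ℓ₁ + ℓ₂ = m then
          ((if A₁ = true then (1 : ℝ) else 0) - (if B₁ = true then 1 else 0)) *
            ((if A₂ = true then (1 : ℝ) else 0) - (if B₂ = true then 1 else 0)) else 0) := by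
  cases A₁ <;> cases B₁ <;> cases A₂ <;> cases B₂ <;>
    simp only [Bool.false_eq_true, false_and, and_false, and_self, if_true, if_false, add_zero, sub_self,
      sub_zero, zero_sub, mul_one, mul_neg, neg_neg, mul_zero, neg_zero] <;>
    split_ifs <;> first | (exfalso; omega) | norm_num

/-- Mirror of `indPair_contract` (the first side fixed). [folklore] -/
theorem indPair_contract₂ (ℓ₁ ℓ₂ ℓc m : ℕ) (A₁ B₁ A₂ B₂ : Bool) (hA : A₁ = true) (hB : B₁ = true)
    (hc : ℓc + 2 = ℓ₂ + (if A₂ = true then 1 else 0) + (if B₂ = true then 1 else 0)) (hlc : 1 ≤ ℓc) (x : ℝ) :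
    ((if ℓ₁ + ℓ₂ + (if A₁ = true ∧ A₂ = true then 1 else 0) + (if B₁ = true ∧ B₂ = true then 1 else 0) ≤ m
          then (1 : ℝ) else 0) +
        (if ℓ₁ + ℓ₂ + (if B₁ = true ∧ A₂ = true then 1 else 0) + (if A₁ = true ∧ B₂ = true then 1 else 0) ≤ m
          then (1 : ℝ) else 0)) * x =
      2 * (if ℓc ≤ m - ℓ₁ - 2 then x else 0) := by
  subst hA; subst hB
  cases A₂ <;> cases B₂ <;>
    simp only [Bool.false_eq_true, and_false, and_self, if_true, if_false,
      add_zero] at hc ⊢ <;>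
    split_ifs <;> first | (exfalso; omega) | ring

/-- Mirror of `indPair_live`. [folklore] -/
theorem indPair_live₂ (ℓ₁ ℓ₂ ℓa ℓb m : ℕ) (A₁ B₁ A₂ B₂ : Bool) (hAB : (A₁ = true ∧ B₁ = false) ∨ (A₁ = false ∧ B₁ = true))
    (hca : ℓa + 1 = ℓ₂ + (if A₂ = true then 1 else 0)) (hcb : ℓb + 1 = ℓ₂ + (if B₂ = true then 1 else 0))
    (hla : 1 ≤ ℓa) (hlb : 1 ≤ ℓb) (x : ℝ) :
    ((if ℓ₁ + ℓ₂ + (if A₁ = true ∧ A₂ = true then 1 else 0) + (if B₁ = true ∧ B₂ = true then 1 else 0) ≤ m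
          then (1 : ℝ) else 0) +
        (if ℓ₁ + ℓ₂ + (if B₁ = true ∧ A₂ = true then 1 else 0) + (if A₁ = true ∧ B₂ = true then 1 else 0) ≤ m
          then (1 : ℝ) else 0)) * x =
      (if ℓb ≤ m - ℓ₁ - 1 then x else 0) + (if ℓa ≤ m - ℓ₁ - 1 then x else 0) := by
  rcases hAB with ⟨hA, hB⟩ | ⟨hA, hB⟩ <;> subst hA <;> subst hB <;> cases A₂ <;> cases B₂ <;>
    simp only [Bool.false_eq_true, and_false, and_self, and_true, if_true, if_false,
      add_zero] at hca hcb ⊢ <;>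
    split_ifs <;> first | (exfalso; omega) | ring

/-- Mirror of `indPair_del`. [folklore] -/
theorem indPair_del₂ (ℓ₁ ℓ₂ m : ℕ) (A₁ B₁ A₂ B₂ : Bool) (hA : A₁ = false) (hB : B₁ = false) (hl : 1 ≤ ℓ₂) (x : ℝ) :
    ((if ℓ₁ + ℓ₂ + (if A₁ = true ∧ A₂ = true then 1 else 0) + (if B₁ = true ∧ B₂ = true then 1 else 0) ≤ m
          then (1 : ℝ) else 0) +
        (if ℓ₁ + ℓ₂ + (if B₁ = true ∧ A₂ = true then 1 else 0) + (if A₁ = true ∧ B₂ = true then 1 else 0) ≤ m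
          then (1 : ℝ) else 0)) * x =
      2 * (if ℓ₂ ≤ m - ℓ₁ then x else 0) := by
  subst hA; subst hB
  simp only [Bool.false_eq_true, false_and, if_false, add_zero]
  split_ifs <;> first | (exfalso; omega) | ring

/-! ### The cross terms of the odd / even expansion (abstract form) -/
/-- **The cross terms are `−½·𝕌`.**  Abstract setting: blocks `M₁, M₂`, levels `ℓ_i` invariant under `γ_i ↦ M_i ∖ γ_i`, type bits with
`a_i(M_i ∖ γ_i) = b_i(γ_i)`, and two-variable differences with `fh (M₁∖γ₁) γ₂ = −fh γ₁ (M₂∖γ₂)` (likewise `gh`).  With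
`P = ½(fh(·,γ₂)+fh(·,γ̄₂))`, `E = ½(fh(·,γ₂)−fh(·,γ̄₂))`, `Q, D` likewise from `gh`, the sum of `1{typed level ≤ m}·(P·D + E·Q)` is `≤ 0`
whenever `𝕌 = Σ 1{ℓ₁+ℓ₂ = m}([a₁]−[b₁])([a₂]−[b₂])·fh·gh ≥ 0`. [folklore] -/
theorem twoSum_cross_le (M₁ M₂ : Finset (Sym2 V)) (ℓ₁ ℓ₂ : Finset (Sym2 V) → ℕ) (a₁ b₁ a₂ b₂ : Finset (Sym2 V) → Bool)
    (fh gh : Finset (Sym2 V) → Finset (Sym2 V) → ℝ) (m : ℕ)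
    (hℓ₁ : ∀ γ₁ : Finset (Sym2 V), γ₁ ⊆ M₁ → ℓ₁ (M₁ \ γ₁) = ℓ₁ γ₁)
    (hℓ₂ : ∀ γ₂ : Finset (Sym2 V), γ₂ ⊆ M₂ → ℓ₂ (M₂ \ γ₂) = ℓ₂ γ₂)
    (ha₁ : ∀ γ₁ : Finset (Sym2 V), γ₁ ⊆ M₁ → a₁ (M₁ \ γ₁) = b₁ γ₁)
    (hb₁ : ∀ γ₁ : Finset (Sym2 V), γ₁ ⊆ M₁ → b₁ (M₁ \ γ₁) = a₁ γ₁)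
    (ha₂ : ∀ γ₂ : Finset (Sym2 V), γ₂ ⊆ M₂ → a₂ (M₂ \ γ₂) = b₂ γ₂)
    (hb₂ : ∀ γ₂ : Finset (Sym2 V), γ₂ ⊆ M₂ → b₂ (M₂ \ γ₂) = a₂ γ₂)
    (hfh : ∀ γ₁ γ₂ : Finset (Sym2 V), γ₁ ⊆ M₁ → γ₂ ⊆ M₂ → fh (M₁ \ γ₁) γ₂ = -fh γ₁ (M₂ \ γ₂))
    (hgh : ∀ γ₁ γ₂ : Finset (Sym2 V), γ₁ ⊆ M₁ → γ₂ ⊆ M₂ → gh (M₁ \ γ₁) γ₂ = -gh γ₁ (M₂ \ γ₂))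
    (hUU : 0 ≤ ∑ γ₁ ∈ M₁.powerset, ∑ γ₂ ∈ M₂.powerset,
      if ℓ₁ γ₁ + ℓ₂ γ₂ = m then
        ((if a₁ γ₁ = true then (1 : ℝ) else 0) - (if b₁ γ₁ = true then 1 else 0)) *
          ((if a₂ γ₂ = true then (1 : ℝ) else 0) - (if b₂ γ₂ = true then 1 else 0)) * (fh γ₁ γ₂ * gh γ₁ γ₂)
      else 0) :
    ∑ γ₁ ∈ M₁.powerset, ∑ γ₂ ∈ M₂.powerset,
      (if ℓ₁ γ₁ + ℓ₂ γ₂ + (if a₁ γ₁ = true ∧ a₂ γ₂ = true then 1 else 0) + (if b₁ γ₁ = true ∧ b₂ γ₂ = true then 1 else 0) ≤ m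
          then (1 : ℝ) else 0) *
        ((fh γ₁ γ₂ + fh γ₁ (M₂ \ γ₂)) / 2 * ((gh γ₁ γ₂ - gh γ₁ (M₂ \ γ₂)) / 2) +
          (fh γ₁ γ₂ - fh γ₁ (M₂ \ γ₂)) / 2 * ((gh γ₁ γ₂ + gh γ₁ (M₂ \ γ₂)) / 2)) ≤ 0 := by
  -- names for the typed indicator and the bracket
  set ind : Finset (Sym2 V) → Finset (Sym2 V) → ℝ := fun γ₁ γ₂ =>
    if ℓ₁ γ₁ + ℓ₂ γ₂ + (if a₁ γ₁ = true ∧ a₂ γ₂ = true then 1 else 0) + (if b₁ γ₁ = true ∧ b₂ γ₂ = true then 1 else 0) ≤ m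
      then (1 : ℝ) else 0 with hind
  set br : Finset (Sym2 V) → Finset (Sym2 V) → ℝ := fun γ₁ γ₂ =>
    (fh γ₁ γ₂ + fh γ₁ (M₂ \ γ₂)) / 2 * ((gh γ₁ γ₂ - gh γ₁ (M₂ \ γ₂)) / 2) +
      (fh γ₁ γ₂ - fh γ₁ (M₂ \ γ₂)) / 2 * ((gh γ₁ γ₂ + gh γ₁ (M₂ \ γ₂)) / 2) with hbr
  set u₁ : Finset (Sym2 V) → ℝ := fun γ₁ => (if a₁ γ₁ = true then (1 : ℝ) else 0) - (if b₁ γ₁ = true then 1 else 0) with hu₁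
  set u₂ : Finset (Sym2 V) → ℝ := fun γ₂ => (if a₂ γ₂ = true then (1 : ℝ) else 0) - (if b₂ γ₂ = true then 1 else 0) with hu₂
  show ∑ γ₁ ∈ M₁.powerset, ∑ γ₂ ∈ M₂.powerset, ind γ₁ γ₂ * br γ₁ γ₂ ≤ 0
  -- the bracket is `(fh·gh(γ₂) − fh·gh(γ̄₂))/2` and is odd under `γ₁ ↦ M₁ ∖ γ₁`
  have hbr' : ∀ γ₁ γ₂ : Finset (Sym2 V), br γ₁ γ₂ = (fh γ₁ γ₂ * gh γ₁ γ₂ - fh γ₁ (M₂ \ γ₂) * gh γ₁ (M₂ \ γ₂)) / 2 := by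
    intro γ₁ γ₂; simp only [hbr]; ring
  have br_flip : ∀ γ₁ γ₂ : Finset (Sym2 V), γ₁ ⊆ M₁ → γ₂ ⊆ M₂ → br (M₁ \ γ₁) γ₂ = -br γ₁ γ₂ := by
    intro γ₁ γ₂ hγ₁ hγ₂
    rw [hbr', hbr', hfh γ₁ γ₂ hγ₁ hγ₂, hgh γ₁ γ₂ hγ₁ hγ₂, hfh γ₁ (M₂ \ γ₂) hγ₁ Finset.sdiff_subset,
      hgh γ₁ (M₂ \ γ₂) hγ₁ Finset.sdiff_subset, Finset.sdiff_sdiff_eq_self hγ₂]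
    ring
  -- symmetrise over `γ₁ ↦ M₁ ∖ γ₁`
  have hsym : ∑ γ₁ ∈ M₁.powerset, ∑ γ₂ ∈ M₂.powerset, ind γ₁ γ₂ * br γ₁ γ₂ =
      (∑ γ₁ ∈ M₁.powerset, ∑ γ₂ ∈ M₂.powerset, (ind γ₁ γ₂ - ind (M₁ \ γ₁) γ₂) * br γ₁ γ₂) / 2 := by
    have h2 := sum_powerset_flip M₁ (fun γ₁ => ∑ γ₂ ∈ M₂.powerset, ind γ₁ γ₂ * br γ₁ γ₂)
    have h3 : ∑ γ₁ ∈ M₁.powerset, ∑ γ₂ ∈ M₂.powerset, ind (M₁ \ γ₁) γ₂ * br (M₁ \ γ₁) γ₂ =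
        ∑ γ₁ ∈ M₁.powerset, ∑ γ₂ ∈ M₂.powerset, -(ind (M₁ \ γ₁) γ₂ * br γ₁ γ₂) := by
      refine Finset.sum_congr rfl fun γ₁ hγ₁ => Finset.sum_congr rfl fun γ₂ hγ₂ => ?_
      rw [br_flip γ₁ γ₂ (Finset.mem_powerset.1 hγ₁) (Finset.mem_powerset.1 hγ₂)]; ring
    rw [h3] at h2
    have h4 : ∑ γ₁ ∈ M₁.powerset, ∑ γ₂ ∈ M₂.powerset, (ind γ₁ γ₂ - ind (M₁ \ γ₁) γ₂) * br γ₁ γ₂ =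
        (∑ γ₁ ∈ M₁.powerset, ∑ γ₂ ∈ M₂.powerset, ind γ₁ γ₂ * br γ₁ γ₂) +
          ∑ γ₁ ∈ M₁.powerset, ∑ γ₂ ∈ M₂.powerset, -(ind (M₁ \ γ₁) γ₂ * br γ₁ γ₂) := by
      rw [← Finset.sum_add_distrib]
      refine Finset.sum_congr rfl fun γ₁ _ => ?_
      rw [← Finset.sum_add_distrib]
      exact Finset.sum_congr rfl fun γ₂ _ => by ring
    rw [h4, ← h2]; ring
  rw [hsym]
  -- pointwise: the antisymmetrised indicator is the cross kernel
  have hpt : ∀ γ₁ γ₂ : Finset (Sym2 V), γ₁ ⊆ M₁ → γ₂ ⊆ M₂ →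
      (ind γ₁ γ₂ - ind (M₁ \ γ₁) γ₂) * br γ₁ γ₂ =
      -((if ℓ₁ γ₁ + ℓ₂ γ₂ = m then u₁ γ₁ * u₂ γ₂ else 0) *
          (fh γ₁ γ₂ * gh γ₁ γ₂ - fh γ₁ (M₂ \ γ₂) * gh γ₁ (M₂ \ γ₂))) / 2 := by
    intro γ₁ γ₂ hγ₁ hγ₂
    have hker : ind γ₁ γ₂ - ind (M₁ \ γ₁) γ₂ = -(if ℓ₁ γ₁ + ℓ₂ γ₂ = m then u₁ γ₁ * u₂ γ₂ else 0) := by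
      simp only [hind, hu₁, hu₂, ha₁ γ₁ hγ₁, hb₁ γ₁ hγ₁, hℓ₁ γ₁ hγ₁]
      exact indDiff_kernel _ _ _ (a₁ γ₁) (b₁ γ₁) (a₂ γ₂) (b₂ γ₂)
    rw [hker, hbr']; ring
  have hsumC : ∑ γ₁ ∈ M₁.powerset, ∑ γ₂ ∈ M₂.powerset, (ind γ₁ γ₂ - ind (M₁ \ γ₁) γ₂) * br γ₁ γ₂ =
      -(∑ γ₁ ∈ M₁.powerset, ∑ γ₂ ∈ M₂.powerset,
        (if ℓ₁ γ₁ + ℓ₂ γ₂ = m then u₁ γ₁ * u₂ γ₂ else 0) * (fh γ₁ γ₂ * gh γ₁ γ₂)) := by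
    have e1 : ∑ γ₁ ∈ M₁.powerset, ∑ γ₂ ∈ M₂.powerset, (ind γ₁ γ₂ - ind (M₁ \ γ₁) γ₂) * br γ₁ γ₂ =
        ∑ γ₁ ∈ M₁.powerset, ∑ γ₂ ∈ M₂.powerset,
          -((if ℓ₁ γ₁ + ℓ₂ γ₂ = m then u₁ γ₁ * u₂ γ₂ else 0) *
            (fh γ₁ γ₂ * gh γ₁ γ₂ - fh γ₁ (M₂ \ γ₂) * gh γ₁ (M₂ \ γ₂))) / 2 :=
      Finset.sum_congr rfl fun γ₁ hγ₁ => Finset.sum_congr rfl fun γ₂ hγ₂ =>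
        hpt γ₁ γ₂ (Finset.mem_powerset.1 hγ₁) (Finset.mem_powerset.1 hγ₂)
    have e2 : ∀ γ₁ : Finset (Sym2 V), γ₁ ⊆ M₁ →
        ∑ γ₂ ∈ M₂.powerset, (if ℓ₁ γ₁ + ℓ₂ γ₂ = m then u₁ γ₁ * u₂ γ₂ else 0) * (fh γ₁ (M₂ \ γ₂) * gh γ₁ (M₂ \ γ₂)) =
        -∑ γ₂ ∈ M₂.powerset, (if ℓ₁ γ₁ + ℓ₂ γ₂ = m then u₁ γ₁ * u₂ γ₂ else 0) * (fh γ₁ γ₂ * gh γ₁ γ₂) := by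
      intro γ₁ hγ₁
      rw [sum_powerset_flip M₂ (fun γ₂ => (if ℓ₁ γ₁ + ℓ₂ γ₂ = m then u₁ γ₁ * u₂ γ₂ else 0) *
        (fh γ₁ (M₂ \ γ₂) * gh γ₁ (M₂ \ γ₂))), ← Finset.sum_neg_distrib]
      refine Finset.sum_congr rfl fun γ₂ hγ₂ => ?_
      have hγ₂' : γ₂ ⊆ M₂ := Finset.mem_powerset.1 hγ₂
      have hu : u₂ (M₂ \ γ₂) = -u₂ γ₂ := by
        simp only [hu₂, ha₂ γ₂ hγ₂', hb₂ γ₂ hγ₂']; ring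
      simp only [Finset.sdiff_sdiff_eq_self hγ₂', hℓ₂ γ₂ hγ₂', hu]
      split_ifs <;> ring
    rw [e1, ← Finset.sum_neg_distrib]
    refine Finset.sum_congr rfl fun γ₁ hγ₁ => ?_
    have hγ₁' : γ₁ ⊆ M₁ := Finset.mem_powerset.1 hγ₁
    have split : ∑ γ₂ ∈ M₂.powerset,
        -((if ℓ₁ γ₁ + ℓ₂ γ₂ = m then u₁ γ₁ * u₂ γ₂ else 0) *
          (fh γ₁ γ₂ * gh γ₁ γ₂ - fh γ₁ (M₂ \ γ₂) * gh γ₁ (M₂ \ γ₂))) / 2 =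
        (-(∑ γ₂ ∈ M₂.powerset, (if ℓ₁ γ₁ + ℓ₂ γ₂ = m then u₁ γ₁ * u₂ γ₂ else 0) * (fh γ₁ γ₂ * gh γ₁ γ₂)) +
          ∑ γ₂ ∈ M₂.powerset, (if ℓ₁ γ₁ + ℓ₂ γ₂ = m then u₁ γ₁ * u₂ γ₂ else 0) *
            (fh γ₁ (M₂ \ γ₂) * gh γ₁ (M₂ \ γ₂))) / 2 := by
      rw [← Finset.sum_neg_distrib, ← Finset.sum_add_distrib, Finset.sum_div]
      exact Finset.sum_congr rfl fun γ₂ _ => by ring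
    rw [split, e2 γ₁ hγ₁']; ring
  rw [hsumC]
  have hU : ∑ γ₁ ∈ M₁.powerset, ∑ γ₂ ∈ M₂.powerset,
      (if ℓ₁ γ₁ + ℓ₂ γ₂ = m then u₁ γ₁ * u₂ γ₂ else 0) * (fh γ₁ γ₂ * gh γ₁ γ₂) =
      ∑ γ₁ ∈ M₁.powerset, ∑ γ₂ ∈ M₂.powerset,
        if ℓ₁ γ₁ + ℓ₂ γ₂ = m then
          ((if a₁ γ₁ = true then (1 : ℝ) else 0) - (if b₁ γ₁ = true then 1 else 0)) *
            ((if a₂ γ₂ = true then (1 : ℝ) else 0) - (if b₂ γ₂ = true then 1 else 0)) * (fh γ₁ γ₂ * gh γ₁ γ₂)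
        else 0 := by
    refine Finset.sum_congr rfl fun γ₁ _ => Finset.sum_congr rfl fun γ₂ _ => ?_
    simp only [hu₁, hu₂]
    split_ifs <;> ring
  rw [hU]
  refine div_nonpos_of_nonpos_of_nonneg ?_ (by norm_num)
  linarith

end FK

end Summit.CriticalPhenomena.PercolationContinuityZ3.Theorems

end
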